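import Literature.NumberTheory.Rogawski1990.RankOneUnstableTransferWildCoreOfShellWindow        -- ★ p844134 F0P3a-p04 (g14): the (γ) layer `rankOneUnstable_core_of_shellWindow` (brings ★ fold p843587)
import Literature.NumberTheory.Rogawski1990.RankOneUnstableWildBookkeeping                    -- ★ p844144 B-p12 (g30): (Ψ4-book) `exists_book_of_wildLaw` (brings ★ p844015 ∕ p844075, ★ A-p03 p844089, ★ R-4 `exists_skew_ne_zero`)
import Literature.NumberTheory.Rogawski1990.RankOneUnstableRamifiedUnitSimilitudeOnePlace     -- ★ p843591 A-p19 (g23): R-0b `exists_unitSimilitudePartner_onePlace_of_ramified` (brings ★ R-0 p843548, `ramificationIdx'_ne_one_of_not_isUnramifiedIn`)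
import Literature.NumberTheory.Rogawski1990.RankOneUnstableDeltaValueRamifiedTorusUniform     -- ★ p844183 A-p19 (g23): (Ψ4-Δ) `exists_rankOneDelta_mul_symbol_eq_of_ramified`
import Literature.NumberTheory.Rogawski1990.RankOneUnstableCoreConjTransport                  -- ★ p844250 B-p14 (g33): (P2) `core_of_core_conj` (brings ★ `isRegularElt_val_conj`)
import Literature.NumberTheory.Automorphic.RamifiedPlaceEisensteinRescale                     -- ★ p844231 A-p01 (g22): `eisensteinBasis_rescale` (brings ★ CM0 p844116 `exists_eisenstein_coeffs_of_ramified'`)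
import Literature.NumberTheory.Automorphic.RamifiedPlaceAntiFixedDichotomy                    -- ★ `exists_units_galAdicCompletionMap_complexConj_eq_neg_of_ramified` (anti-fixed `α`, unit or uniformiser)
import Literature.NumberTheory.Automorphic.UnitaryTwoRamifiedTreeShellDecomposition           -- ★ B-p08: `exists_mem_unitaryGroupOfForm_antidiag_coe_eq_diagonal` (`diag(η, (σ η)⁻¹) ∈ U`)
import Literature.NumberTheory.Automorphic.UnitaryTwoRamifiedTreeAction                       -- ★ B-p08 p843858: `rhoVertexActPlace`, `unitaryGroupOfForm_placeForm_antidiagTwo_eq`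
import Literature.NumberTheory.Automorphic.SLTwoTreeProjectiveAction                          -- ★ `isSpecialLattice_latt_of_valuation_det` (the root vertex `latt 1`)
import Literature.NumberTheory.Automorphic.UnitaryGroupInertPlaceHyperbolicBasis              -- ★ `galAdicCompletionMap_galAdicCompletionMap_of_smul_eq` (`σ_w ∘ σ_w = id`)
import Literature.NumberTheory.Rogawski1990.RankOneKappaRootStabilizerOpen                    -- ★ p844280 F0P3a-p04 (g14) (B6-K): `exists_rootStabilizer_rhoVertexActPlace`
import Literature.NumberTheory.Rogawski1990.RankOneTorusStandardPosition                      -- ★ A-p12 (g20) (P1): `exists_conj_standardPosition`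
import Literature.NumberTheory.Rogawski1990.RankOneUnstableWildLawTorus                       -- ★ p844869 F0P3-p01 (g15) (W′-B6) THE CLOSE: `exists_wildLaw_torus` (brings ★ (B6-V) p844809, ★ (B6-O) p844450∕p844466, ★ Prelude p844590)
import Literature.NumberTheory.Rogawski1990.RankOneUnstableTransferNonsplitCMERamifiedWildOfCore  -- ★ p843935 F0P3-p02 (g13): the W′ closer sibling `…CMERamifiedWild_of_core_wild` (binder shape `hcore_wild`)
import Literature.NumberTheory.Rogawski1990.RankOneUnstableTransferRamifiedCore                -- ★ p844041 F0P3a-p03 (g12): the TAME END `rankOneUnstable_core_ramified_tame`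
import Literature.NumberTheory.Rogawski1990.RankOneUnstableTransferInertCoreClosed             -- ★ p843756 F0P3-p01 (g14): the INERT core `rankOneUnstable_core_inert`
import HarnessLib

/-!
# W′ END — THE WILD-RAMIFIED CORE `rankOneUnstable_core_ramified_wild`, CLOSED, and the junction `…CMERamifiedWild_holds`
# (road «R1LL-WILD» = W′ of «R1LL-tree»; Labesse–Langlands 1979 §2 (2.1)–(2.2); Labesse 2024 Th. 0.0.12; Rogawski 1990 §4.9 Lemma 4.9.3 (4.9.2); architect A-p16 RULINGS A-32∕A-34∕A-37∕A-43…A-47)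

Topic `NumberTheory/Rogawski1990`; namespace `Literature.NumberTheory.Rogawski1990`.  THEOREMS ONLY (no definition, no instance, no notation, no named fact, no `sorry`);
kernel lane `--supports stmt-HodgeConjecture-24833`.  Cell `pub/hodgecm-mathlib` (D-0151), crux H413 = `stmt-HodgeConjecture-24833`, line «N6nsGerm» stub `stub_N6nsR1ramWild :
RankOneUnstableTransferNonsplitCMERamifiedWild` (★ def p843764; pen F0P2-p02).  W′ END assembler F0P3a-p03 (g13) (HEAD shed by the END-WILD owner F0P3a-p04 (g14), 12:07Z).
HONEST LABEL: HC_CM is proved only modulo the printed citations (2 remaining named inputs hLiu418 24832, h413 24833) until rung 0 closes; this file is the composition of ★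
theorems and asserts nothing printed.

§1 `rankOneUnstable_core_ramified_wild_of_pos` — the core at a ramified non-split `w ∣ v` for a framed elliptic torus `(t₀, P, d)` IN STANDARD POSITION w.r.t. an Eisenstein
datum `(α; ϖF; K, x₀; u₀, v₀; τE; ηE, uη)` (binders = ★ (W′-B6) `exists_wildLaw_torus`'s appended block VERBATIM, `hpos` per-`t`).  ONE `obtain` chain: ★ R-0b partner
`e = Ad diag(1,u)` → ★ R-4 skew `η` → ★ (Ψ4-book) `b₀ bc tc K` → ★ (Ψ4-Δ) `N₁ E hE hΔ` → ★ (W′-B6) `m₀ κβ W oβ hO hW hκβ hoβ` → `exact` ★ (γ) layer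
`rankOneUnstable_core_of_shellWindow` (`ε := ((b₀ ·, θ)_v : ℂ)`, `book := fun _ => K`, window bottom `max m₀ Nb`).
§2 THE HEAD `rankOneUnstable_core_ramified_wild` — binders = ★ p843935's `hcore_wild` VERBATIM.  The datum is BUILT: anti-fixed `α` (★ dichotomy), uniformisers `ϖF`, `τ`
(★ `HeckeCharacter.valued_uniformizer`), Eisenstein coefficients (★ CM0), the standard-position conjugator `(ĝ, 1)` and rescaling unit `c` (★ (P1) `exists_conj_standardPosition`),
the rescaled datum (★ `eisensteinBasis_rescale`), `uη` (★ `exists_mem_unitaryGroupOfForm_antidiag_coe_eq_diagonal`), the root `x₀ = latt 1` and its stabiliser `K` (★ (B6-K));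
then ★ (P2) `core_of_core_conj` transports §1 at `((ĝ,1) t₀ (ĝ,1)⁻¹, ĝ·P, d)` back to `(t₀, P, d)`.  UNIFORM in the residue characteristic (`hwild` carried, unused).
§3 `rankOneUnstableTransferNonsplitCMERamifiedWild_holds : RankOneUnstableTransferNonsplitCMERamifiedWild` := ★ p843935 at §2 — closes «N6nsGerm» `stub_N6nsR1ramWild` BY NAME;
`rankOneUnstableTransferNonsplitCMERamified_holds` (★ p844041 junction) and `rankOneUnstableTransferNonsplitCME_holds` (★ p843935 three-core closer at ★ inert p843756, ★ tame p844041, §2):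
the (R1) letter of record with NO named residue — «N6nsGerm» `stub_N6nsR1ram` ∕ `stub_N6nsR1LL` BY NAME.

## References
* [Rogawski1990] J. D. Rogawski, *Automorphic Representations of Unitary Groups in Three Variables*, Ann. of Math. Stud. 123 (1990): §4.9 Lemma 4.9.3, (4.9.2) pp. 54–56; §3.6 pp. 31–32.
* [LabesseLanglands1979] J.-P. Labesse, R. P. Langlands, *L-indistinguishability for SL(2)*, Canad. J. Math. 31 (1979) 726–785: §2 (2.1)–(2.2), Lemma 2.1 pp. 8–10.
* [Labesse2024StabilisationGermesSL2] J.-P. Labesse, *Stabilisation des germes de SL(2)* (arXiv:2411.14820, 2024): Prop. 0.0.10–0.0.11, Th. 0.0.12 pp. 7–8.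
* [Serre1980Trees] J.-P. Serre, *Trees* (1980): Ch. II §1.1–1.3 (the tree of `SL₂`, vertex stabilisers).
-/

set_option autoImplicit false

noncomputable section

open Set Filter Topology MeasureTheory NumberField IsDedekindDomain Finset Matrix ValuativeRel
open scoped Matrix MatrixGroups ValuativeRel

namespace Literature.NumberTheory.Rogawski1990

open Literature.NumberTheory.Automorphic Literature.NumberTheory.Automorphic.UnitaryGroup Literature.NumberTheory.GaloisRepresentations
open Literature.NumberTheory.QuadraticForms Literature.NumberTheory.NumberFields Literature.NumberTheory.Automorphic.HermitianLatticeTree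

section Head

variable (L : Type) [Field L] [NumberField L] [IsCMField L] (v : HeightOneSpectrum (𝓞 ↥(maximalRealSubfield L)))

/-- At a place with ONE place of `L` above it, that place is fixed by complex conjugation (local copy of ★ `smul_eq_of_subsingleton_placesOver`).
[cite: CasselsFrohlichANT1967, Ch. VII Prop. 1.2 (ii)] -/
private theorem smul_eq_of_subsingleton_placesOver_ENDW (hv : Subsingleton (PlacesOver L v)) (w : PlacesOver L v) : IsCMField.complexConj L • w.1 = w.1 := by
  have hmem : (IsCMField.complexConj L • w.1).under (𝓞 ↥(maximalRealSubfield L)) = v := by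
    rw [HeightOneSpectrum.under_algEquiv_smul]; exact w.2
  exact congrArg Subtype.val (Subsingleton.elim (⟨IsCMField.complexConj L • w.1, hmem⟩ : PlacesOver L v) w)

/-- `((a,b)_v : ℂ)·((a,b)_v : ℂ) = 1` for a Hilbert symbol (`±1`). [cite: Serre1979, Ch. XIV §3] -/
private theorem cast_hilbertSymbol_mul_self_ENDW {F : Type*} [Field F] (a b : F) :
    ((hilbertSymbol F a b : ℤ) : ℂ) * ((hilbertSymbol F a b : ℤ) : ℂ) = 1 := by
  unfold hilbertSymbol
  split_ifs <;> norm_num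

/-- **The frame transports along conjugation of the datum**: `t₀ P = P·diag d ⇒ (g t₀ g⁻¹)·(g P) = (g P)·diag d`. [cite: Rogawski1990, §4.9 p. 56] -/
private theorem frame_conj_mul_ENDW (g t₀ : ((cmDatum L 2 (Matrix.of fun i j : Fin 2 => if i.val + j.val + 1 = 2 then (1 : L) else 0)).Local v × (cmDatum L 1 (Matrix.of fun i j : Fin 1 => if i.val + j.val + 1 = 1 then (1 : L) else 0)).Local v)) (P : GL (Fin 2) (LocalRing L v)) (d : Fin 2 → (LocalRing L v))
    (hP : (t₀.1.val.val : Matrix (Fin 2) (Fin 2) (LocalRing L v)) * P.val = P.val * Matrix.diagonal d) :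
    ((g * t₀ * g⁻¹ : ((cmDatum L 2 (Matrix.of fun i j : Fin 2 => if i.val + j.val + 1 = 2 then (1 : L) else 0)).Local v × (cmDatum L 1 (Matrix.of fun i j : Fin 1 => if i.val + j.val + 1 = 1 then (1 : L) else 0)).Local v)).1.val.val : Matrix (Fin 2) (Fin 2) (LocalRing L v)) * (g.1.val * P).val = (g.1.val * P).val * Matrix.diagonal d := by
  have h1 : ((g * t₀ * g⁻¹ : ((cmDatum L 2 (Matrix.of fun i j : Fin 2 => if i.val + j.val + 1 = 2 then (1 : L) else 0)).Local v × (cmDatum L 1 (Matrix.of fun i j : Fin 1 => if i.val + j.val + 1 = 1 then (1 : L) else 0)).Local v)).1.val : GL (Fin 2) (LocalRing L v)) = g.1.val * t₀.1.val * g.1.val⁻¹ := rfl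
  rw [h1]
  simp only [Units.val_mul]
  rw [Matrix.mul_assoc _ ((g.1.val⁻¹).val : Matrix (Fin 2) (Fin 2) (LocalRing L v)), ← Matrix.mul_assoc ((g.1.val⁻¹).val : Matrix (Fin 2) (Fin 2) (LocalRing L v)),
    Units.inv_mul, Matrix.one_mul, Matrix.mul_assoc, hP, ← Matrix.mul_assoc]

/-! ## §1 The core in standard position -/

-- `L_w`-sized statement and a long composition: elaboration budget only (no search)
set_option maxHeartbeats 1600000 in
/-- **(R1-core) AT A RAMIFIED PLACE, FOR A TORUS IN STANDARD POSITION w.r.t. AN EISENSTEIN DATUM** (see the module docstring, §1; the datum binders are the appended block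
of ★ `exists_wildLaw_torus` VERBATIM).  Output = the core body of ★ p843417 ∕ p843935 at `(t₀, P)`.
[cite: Rogawski1990, §4.9 Lemma 4.9.3, (4.9.2) pp. 54–56] [cite: LabesseLanglands1979, §2 (2.1)–(2.2) pp. 8–10] [cite: Labesse2024StabilisationGermesSL2, Th. 0.0.12] -/
theorem rankOneUnstable_core_ramified_wild_of_pos (w : PlacesOver L v) (hw : IsCMField.complexConj L • w.1 = w.1) (he : v.asIdeal.ramificationIdx' w.1.asIdeal ≠ 1)
    (μ : HeckeCharacter L) [MeasurableSpace ((cmDatum L 2 (Matrix.of fun i j : Fin 2 => if i.val + j.val + 1 = 2 then (1 : L) else 0)).Local v × (cmDatum L 1 (Matrix.of fun i j : Fin 1 => if i.val + j.val + 1 = 1 then (1 : L) else 0)).Local v)] [BorelSpace ((cmDatum L 2 (Matrix.of fun i j : Fin 2 => if i.val + j.val + 1 = 2 then (1 : L) else 0)).Local v × (cmDatum L 1 (Matrix.of fun i j : Fin 1 => if i.val + j.val + 1 = 1 then (1 : L) else 0)).Local v)] (ν : Measure ((cmDatum L 2 (Matrix.of fun i j : Fin 2 => if i.val + j.val + 1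 = 2 then (1 : L) else 0)).Local v × (cmDatum L 1 (Matrix.of fun i j : Fin 1 => if i.val + j.val + 1 = 1 then (1 : L) else 0)).Local v)) [ν.IsHaarMeasure] [ν.IsMulRightInvariant]
    (hμω : ∀ x : ideleGroup ↥(maximalRealSubfield L), μ (AdeleRing.ideleBaseChange (↥(maximalRealSubfield L)) L x) = quadraticHeckeCharCM L x)
    (f : ((cmDatum L 2 (Matrix.of fun i j : Fin 2 => if i.val + j.val + 1 = 2 then (1 : L) else 0)).Local v × (cmDatum L 1 (Matrix.of fun i j : Fin 1 => if i.val + j.val + 1 = 1 then (1 : L) else 0)).Local v) → ℂ) (hf : IsLocSmooth f)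
    (t₀ : ((cmDatum L 2 (Matrix.of fun i j : Fin 2 => if i.val + j.val + 1 = 2 then (1 : L) else 0)).Local v × (cmDatum L 1 (Matrix.of fun i j : Fin 1 => if i.val + j.val + 1 = 1 then (1 : L) else 0)).Local v)) (P : GL (Fin 2) (LocalRing L v)) (d : Fin 2 → (LocalRing L v))
    (ht₀ : IsRegularElt (t₀.1.val : GL (Fin 2) (LocalRing L v)))
    (hP : (t₀.1.val.val : Matrix (Fin 2) (Fin 2) (LocalRing L v)) * P.val = P.val * Matrix.diagonal d)
    (hd1 : ∀ i, conjLocal L (IsCMField.complexConj L) v (d i) * d i = 1)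
    (E₂ : (cmDatum L 2 (Matrix.of fun i j : Fin 2 => if i.val + j.val + 1 = 2 then (1 : L) else 0)).Local v ≃ₜ* ↥(unitaryGroupOfForm (galAdicCompletionMap (L := L) (IsCMField.complexConj L) hw) (placeForm (Matrix.of fun i j : Fin 2 => if i.val + j.val + 1 = 2 then (1 : L) else 0) w.1))) (hE₂ : ∀ g, (((E₂ g) : ↥(unitaryGroupOfForm (galAdicCompletionMap (L := L) (IsCMField.complexConj L) hw) (placeForm (Matrix.of fun i j : Fin 2 => if i.val + j.val + 1 = 2 then (1 : L) else 0) w.1))) : GL (Fin 2) (w.1.adicCompletion L)) = ((localNonsplitEquiv (IsCMField.complexConj L) (Matrix.of fun i j : Fin 2 => if i.val + j.val + 1 = 2 then (1 : L) else 0) (IsCMField.complexConj_ne_one L) w hw g : ↥(unitaryGroupOfForm (galAdicCompletionMap (L := L) (IsCMField.complexConj L) hw) (placeForm (Matrix.of fun i j : Fin 2 => if i.val + j.val + 1 = 2 then (1 : L) else 0) w.1))) : GL (Fin 2) (w.1.adicCompletion L)))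
    {α : (w.1.adicCompletion L)} (hα : (galAdicCompletionMap (L := L) (IsCMField.complexConj L) hw) α = -α) (hα0 : α ≠ 0)
    {ϖF : v.adicCompletion ↥(maximalRealSubfield L)} (hϖF : Valued.v ϖF = WithZero.exp (-1 : ℤ))
    (K : Subgroup ((cmDatum L 2 (Matrix.of fun i j : Fin 2 => if i.val + j.val + 1 = 2 then (1 : L) else 0)).Local v))
    (x₀ : {M : Submodule 𝒪[v.adicCompletion ↥(maximalRealSubfield L)] (Fin 2 → v.adicCompletion ↥(maximalRealSubfield L)) // IsSpecialLattice (RingHom.id _) ϖF !![(0 : v.adicCompletion ↥(maximalRealSubfield L)), 1; -1, 0] M})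
    (hx₀ : x₀.1 = latt (1 : Matrix (Fin 2) (Fin 2) (v.adicCompletion ↥(maximalRealSubfield L))))
    (hK : ∀ g, g ∈ K ↔ rhoVertexActPlace L v w hw hα hα0 hϖF (E₂ g) x₀ = x₀) (hKo : IsOpen ((((K.prod (⊤ : Subgroup ((cmDatum L 1 (Matrix.of fun i j : Fin 1 => if i.val + j.val + 1 = 1 then (1 : L) else 0)).Local v))) : Subgroup ((cmDatum L 2 (Matrix.of fun i j : Fin 2 => if i.val + j.val + 1 = 2 then (1 : L) else 0)).Local v × (cmDatum L 1 (Matrix.of fun i j : Fin 1 => if i.val + j.val + 1 = 1 then (1 : L) else 0)).Local v))) : Set ((cmDatum L 2 (Matrix.of fun i j : Fin 2 => if i.val + j.val + 1 = 2 then (1 : L) else 0)).Local v × (cmDatum L 1 (Matrix.of fun i j : Fin 1 => if i.val + j.val + 1 = 1 then (1 : L) else 0)).Local v)))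
    (hKc : IsCompact ((((K.prod (⊤ : Subgroup ((cmDatum L 1 (Matrix.of fun i j : Fin 1 => if i.val + j.val + 1 = 1 then (1 : L) else 0)).Local v))) : Subgroup ((cmDatum L 2 (Matrix.of fun i j : Fin 2 => if i.val + j.val + 1 = 2 then (1 : L) else 0)).Local v × (cmDatum L 1 (Matrix.of fun i j : Fin 1 => if i.val + j.val + 1 = 1 then (1 : L) else 0)).Local v))) : Set ((cmDatum L 2 (Matrix.of fun i j : Fin 2 => if i.val + j.val + 1 = 2 then (1 : L) else 0)).Local v × (cmDatum L 1 (Matrix.of fun i j : Fin 1 => if i.val + j.val + 1 = 1 then (1 : L) else 0)).Local v)))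
    {u₀ v₀ : v.adicCompletion ↥(maximalRealSubfield L)} (hu : u₀ ∈ 𝒪[v.adicCompletion ↥(maximalRealSubfield L)]) (hu1 : valuation (v.adicCompletion ↥(maximalRealSubfield L)) u₀ < 1)
    (hv1 : valuation (v.adicCompletion ↥(maximalRealSubfield L)) v₀ = valuation (v.adicCompletion ↥(maximalRealSubfield L)) ϖF)
    (hE : ∀ p q : v.adicCompletion ↥(maximalRealSubfield L), valuation (v.adicCompletion ↥(maximalRealSubfield L)) (p ^ 2 + p * q * u₀ - q ^ 2 * v₀) ≤ 1 → p ∈ 𝒪[v.adicCompletion ↥(maximalRealSubfield L)] ∧ q ∈ 𝒪[v.adicCompletion ↥(maximalRealSubfield L)])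
    {τE : (w.1.adicCompletion L)} (hτ : τE * τE = toPlace v w u₀ * τE + toPlace v w v₀) (hστ : (galAdicCompletionMap (L := L) (IsCMField.complexConj L) hw) τE = toPlace v w u₀ - τE)
    (ηE : ((w.1.adicCompletion L))ˣ) (hηE : Valued.v (ηE : (w.1.adicCompletion L)) = WithZero.exp (-1 : ℤ))
    (uη : ↥(unitaryGroupOfForm (galAdicCompletionMap (L := L) (IsCMField.complexConj L) hw) (placeForm (Matrix.of fun i j : Fin 2 => if i.val + j.val + 1 = 2 then (1 : L) else 0) w.1))) (huη : (((uη : ↥(unitaryGroupOfForm (galAdicCompletionMap (L := L) (IsCMField.complexConj L) hw) (placeForm (Matrix.of fun i j : Fin 2 => if i.val + j.val + 1 = 2 then (1 : L) else 0) w.1))) : GL (Fin 2) (w.1.adicCompletion L)) : Matrix (Fin 2) (Fin 2) (w.1.adicCompletion L)) = Matrix.diagonal ![(ηE : (w.1.adicCompletion L)), ((galAdicCompletionMap (L := L) (IsCMField.complexConj L) hw) (ηE : (w.1.adicCompletion L)))⁻¹])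
    (hpos : ∀ t : ↥(Subgroup.centralizer ({t₀} : Set ((cmDatum L 2 (Matrix.of fun i j : Fin 2 => if i.val + j.val + 1 = 2 then (1 : L) else 0)).Local v × (cmDatum L 1 (Matrix.of fun i j : Fin 1 => if i.val + j.val + 1 = 1 then (1 : L) else 0)).Local v))), ∃ (s : (w.1.adicCompletion L)) (γ : GL (Fin 2) (v.adicCompletion ↥(maximalRealSubfield L))) (a b : (v.adicCompletion ↥(maximalRealSubfield L))), (γ : Matrix (Fin 2) (Fin 2) (v.adicCompletion ↥(maximalRealSubfield L))) = !![a, b * v₀; b, a + b * u₀] ∧ Matrix.diagonal ![1, α] * (((((E₂ (t : ((cmDatum L 2 (Matrix.of fun i j : Fin 2 => if i.val + j.val + 1 = 2 then (1 : L) else 0)).Local v × (cmDatum L 1 (Matrix.of fun i j : Fin 1 => if i.val + j.val + 1 = 1 then (1 : L) else 0)).Local v)).1) : ↥(unitaryGroupOfForm (galAdicCompletionMap (L := L) (IsCMField.complexConj L) hw) (placeForm (Matrix.of fun i j : Fin 2 => if i.val + j.val + 1 = 2 then (1 : L) else 0) w.1))) : GL (Fin 2) (w.1.adicCompletion L)))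 : Matrix (Fin 2) (Fin 2) (w.1.adicCompletion L)) * Matrix.diagonal ![1, α⁻¹] = s • (γ : Matrix (Fin 2) (Fin 2) (v.adicCompletion ↥(maximalRealSubfield L))).map (toPlace v w))
    :
    ∃ fC : ↥(Subgroup.centralizer ({t₀} : Set ((cmDatum L 2 (Matrix.of fun i j : Fin 2 => if i.val + j.val + 1 = 2 then (1 : L) else 0)).Local v × (cmDatum L 1 (Matrix.of fun i j : Fin 1 => if i.val + j.val + 1 = 1 then (1 : L) else 0)).Local v))) → ℂ, IsLocallyConstant fC ∧
      ∀ t : ↥(Subgroup.centralizer ({t₀} : Set ((cmDatum L 2 (Matrix.of fun i j : Fin 2 => if i.val + j.val + 1 = 2 then (1 : L) else 0)).Local v × (cmDatum L 1 (Matrix.of fun i j : Fin 1 => if i.val + j.val + 1 = 1 then (1 : L) else 0)).Local v))), IsRegularElt ((t : ((cmDatum L 2 (Matrix.of fun i j : Fin 2 => if i.val + j.val + 1 = 2 then (1 : L) else 0)).Local v × (cmDatum L 1 (Matrix.of fun i j : Fin 1 => if i.val + j.val + 1 = 1 then (1 : L) else 0)).Local v)).1.val : GL (Fin 2) (LocalRing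 L v)) → ∀ t' : ((cmDatum L 2 (Matrix.of fun i j : Fin 2 => if i.val + j.val + 1 = 2 then (1 : L) else 0)).Local v × (cmDatum L 1 (Matrix.of fun i j : Fin 1 => if i.val + j.val + 1 = 1 then (1 : L) else 0)).Local v),
        IsLocalStablyConjH L v (t : ((cmDatum L 2 (Matrix.of fun i j : Fin 2 => if i.val + j.val + 1 = 2 then (1 : L) else 0)).Local v × (cmDatum L 1 (Matrix.of fun i j : Fin 1 => if i.val + j.val + 1 = 1 then (1 : L) else 0)).Local v)) t' → ¬ IsConj (t : ((cmDatum L 2 (Matrix.of fun i j : Fin 2 => if i.val + j.val + 1 = 2 then (1 : L) else 0)).Local v × (cmDatum L 1 (Matrix.of fun i j : Fin 1 => if i.val + j.val + 1 = 1 then (1 : L) else 0)).Local v)) t' →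
        ((finHeckeValue L v μ (((P⁻¹).val * ((t : ((cmDatum L 2 (Matrix.of fun i j : Fin 2 => if i.val + j.val + 1 = 2 then (1 : L) else 0)).Local v × (cmDatum L 1 (Matrix.of fun i j : Fin 1 => if i.val + j.val + 1 = 1 then (1 : L) else 0)).Local v)).1.val.val : Matrix (Fin 2) (Fin 2) (LocalRing L v)) * P.val) 0 0 - ((P⁻¹).val * ((t : ((cmDatum L 2 (Matrix.of fun i j : Fin 2 => if i.val + j.val + 1 = 2 then (1 : L) else 0)).Local v × (cmDatum L 1 (Matrix.of fun i j : Fin 1 => if i.val + j.val + 1 = 1 then (1 : L) else 0)).Local v)).1.val.val : Matrix (Fin 2) (Fin 2) (LocalRing L v)) * P.val) 1 1))⁻¹ : ℂ) * ((Real.sqrt (∏ w' : PlacesOver L v, ‖(((P⁻¹).val * ((t : ((cmDatum L 2 (Matrix.of fun i j : Fin 2 => if i.val + j.val + 1 = 2 then (1 : L) else 0)).Local v × (cmDatum L 1 (Matrix.of fun i j : Fin 1 => if i.val + j.val + 1 = 1 then (1 : L) else 0)).Local v)).1.val.val : Matrix (Fin 2) (Fin 2) (LocalRing L v)) * P.val)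 0 0 - ((P⁻¹).val * ((t : ((cmDatum L 2 (Matrix.of fun i j : Fin 2 => if i.val + j.val + 1 = 2 then (1 : L) else 0)).Local v × (cmDatum L 1 (Matrix.of fun i j : Fin 1 => if i.val + j.val + 1 = 1 then (1 : L) else 0)).Local v)).1.val.val : Matrix (Fin 2) (Fin 2) (LocalRing L v)) * P.val) 1 1) w'‖) : ℝ) : ℂ) * ((∫ y, f (y * (t : ((cmDatum L 2 (Matrix.of fun i j : Fin 2 => if i.val + j.val + 1 = 2 then (1 : L) else 0)).Local v × (cmDatum L 1 (Matrix.of fun i j : Fin 1 => if i.val + j.val + 1 = 1 then (1 : L) else 0)).Local v)) * y⁻¹) ∂ν) - ∫ y, f (y * t' * y⁻¹) ∂ν) = fC t := by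
  classical
  have hc1 : IsCMField.complexConj L ≠ 1 := IsCMField.complexConj_ne_one L
  haveI hv : Subsingleton (PlacesOver L v) := PlacesOver.subsingleton_of_smul_eq (IsCMField.complexConj L) hc1 w hw
  -- ★ R-0b: the ramified unit-similitude partner `e = Ad diag(1, u)`, `u ∈ 𝒪_wˣ` `σ_w`-fixed and not a norm, with its one-place conjugation law and `hest`
  obtain ⟨r, hru, u, e, _hrσ, _hrv, _hrn, hAd, _hframe, hest, _hK, _hν, _huval, hvu, hσu, hun, hconj, _hDint, _hlev⟩ :=
    exists_unitSimilitudePartner_onePlace_of_ramified L v w hw he t₀ P d ht₀ hP hd1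
  have hconjE : ∀ a : ((cmDatum L 2 (Matrix.of fun i j : Fin 2 => if i.val + j.val + 1 = 2 then (1 : L) else 0)).Local v × (cmDatum L 1 (Matrix.of fun i j : Fin 1 => if i.val + j.val + 1 = 1 then (1 : L) else 0)).Local v), (((E₂ (e a).1) : ↥(unitaryGroupOfForm (galAdicCompletionMap (L := L) (IsCMField.complexConj L) hw) (placeForm (Matrix.of fun i j : Fin 2 => if i.val + j.val + 1 = 2 then (1 : L) else 0) w.1))) : GL (Fin 2) (w.1.adicCompletion L)) = (glDiagonal 2 (w.1.adicCompletion L) ![1, u]) * (((E₂ a.1) : ↥(unitaryGroupOfForm (galAdicCompletionMap (L := L) (IsCMField.complexConj L) hw) (placeForm (Matrix.of fun i j : Fin 2 => if i.val + j.val + 1 = 2 then (1 : L) else 0) w.1))) : GL (Fin 2) (w.1.adicCompletion L)) * (glDiagonal 2 (w.1.adicCompletion L) ![1, u])⁻¹ :=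
    fun a => by rw [hE₂, hE₂]; exact hconj a
  -- ★ R-4: a skew element `η` (`σ_w η = −η`, `η ≠ 0`)
  obtain ⟨η, hση, hη0⟩ := exists_skew_ne_zero L v w hw
  -- ★ (Ψ4-book): the torus coordinates `b₀ bc tc`, their specs above `Nb`, and the bookkeeping constant `Kb ≠ 0`
  obtain ⟨Nb, b₀, bc, tc, Kb, _hK0, hspec, hKb⟩ := exists_book_of_wildLaw L v w hw he t₀ P d ht₀ hP hd1 hση hη0
  -- ★ (Ψ4-Δ): the uniform `Δ`-law at THAT `b₀`
  obtain ⟨N₁, E, hE', hΔ⟩ := exists_rankOneDelta_mul_symbol_eq_of_ramified L v w hw he μ hμω t₀ P d ht₀ hP hd1 hση hη0 b₀ Nb (fun t ht hNb => (hspec t ht hNb).1)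
  -- (W′-B6): the wild law on the torus at THAT `bc`
  obtain ⟨m₀, κβ, W, oβ, hO, hW, hκβ, hoβ⟩ := exists_wildLaw_torus L v w hw ν f hf t₀ P d ht₀ hP hd1 he u hvu hσu hun E₂ hE₂ e (fun a => (hAd a).2) hconjE
    (fun t ht => (hest t ht).1) η hση hη0 bc Nb (fun t ht hNb => (hspec t ht hNb).2.1) hα hα0 hϖF K x₀ hx₀ hK hKo hKc hu hu1 hv1 hE hτ hστ ηE hηE uη huη hpos
  -- `q = #(𝓞_{L⁺}∕v) ≠ 0`, `ε := (b₀ ·, θ)_v` with `ε² = 1`; the (γ) layer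
  have hq : (((Nat.card (𝓞 ↥(maximalRealSubfield L) ⧸ v.asIdeal)) : ℕ) : ℂ) ≠ 0 := Nat.cast_ne_zero.2 (Nat.card_pos (α := 𝓞 ↥(maximalRealSubfield L) ⧸ v.asIdeal)).ne'
  exact rankOneUnstable_core_of_shellWindow L v hv w μ ν f hf t₀ P d ht₀ hP hd1 e hest (Nat.card (𝓞 ↥(maximalRealSubfield L) ⧸ v.asIdeal)) hq (fun t => ((hilbertSymbol (v.adicCompletion ↥(maximalRealSubfield L)) ((b₀ t : (v.adicCompletion ↥(maximalRealSubfield L)))) (algebraMap ↥(maximalRealSubfield L) _ ((cmQuadraticGenerator L : 𝓞 ↥(maximalRealSubfield L)) : ↥(maximalRealSubfield L))) : ℤ) : ℂ))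
    (fun t _ => cast_hilbertSymbol_mul_self_ENDW _ _) (max m₀ Nb) κβ W (fun _ => Kb) oβ
    (fun t ht hm => hO t ht (le_of_max_le_left hm)) hW (fun s _ => Filter.Eventually.of_forall fun _ _ => rfl)
    (fun t ht hm => (hKb κβ oβ m₀ hκβ hoβ t ht (le_of_max_le_right hm) (le_of_max_le_left hm)).symm) N₁ E hE' hΔ

/-! ## §2 The head: the datum built, standard position reached by conjugation, the core transported back -/

-- `L_w`-sized statement and a long composition: elaboration budget only (no search)
set_option maxHeartbeats 1600000 in
/-- **(R1-core) AT A WILDLY (indeed ANY) RAMIFIED PLACE — THE W′ END HEAD, CLOSED** (binders = ★ p843935 `hcore_wild` VERBATIM; see the module docstring §2 for the chain).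
At a finite place `v` of `L⁺` with ONE place `w` of the CM field `L` above it, RAMIFIED (`hwild` carried, unused — the proof is uniform), for a Hecke character `μ` of `L`
restricting to `ω_{L∕L⁺}`, a Haar measure `ν` on `H_v`, `f ∈ C_c^∞(H_v)` and an elliptic regular torus `Z(t₀)` framed by `P`: there is a LOCALLY CONSTANT `fC` on `Z(t₀)`
with `Δ(t)·(O_ν(↑t, f) − O_ν(t′, f)) = fC t` for `t` regular and `t′` stably conjugate, not conjugate to `↑t`.
[cite: Rogawski1990, §4.9 Lemma 4.9.3, (4.9.2) pp. 54–56; §3.6 pp. 31–32] [cite: LabesseLanglands1979, §2 (2.1)–(2.2), Lemma 2.1 pp. 8–10] [cite: Labesse2024StabilisationGermesSL2, Th. 0.0.12] -/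
theorem rankOneUnstable_core_ramified_wild (hv : Subsingleton (PlacesOver L v)) (hram : ¬ Algebra.IsUnramifiedIn (𝓞 L) v.asIdeal)
    (hwild : ¬ (∀ w : PlacesOver L v, Valued.v (2 : w.1.adicCompletion L) = 1))
    (μ : HeckeCharacter L) [MeasurableSpace ((cmDatum L 2 (Matrix.of fun i j : Fin 2 => if i.val + j.val + 1 = 2 then (1 : L) else 0)).Local v × (cmDatum L 1 (Matrix.of fun i j : Fin 1 => if i.val + j.val + 1 = 1 then (1 : L) else 0)).Local v)] [BorelSpace ((cmDatum L 2 (Matrix.of fun i j : Fin 2 => if i.val + j.val + 1 = 2 then (1 : L) else 0)).Local v × (cmDatum L 1 (Matrix.of fun i j : Fin 1 => if i.val + j.val + 1 = 1 then (1 : L) else 0)).Local v)] (ν : Measure ((cmDatum L 2 (Matrix.of fun i j : Fin 2 => if i.val + j.val + 1 = 2 then (1 : L) else 0)).Local v × (cmDatum L 1 (Matrix.of fun i j : Fin 1 => if i.val + j.val + 1 = 1 then (1 : L) else 0)).Local v)) [ν.IsHaarMeasure] [ν.IsMulRightInvariant]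
    (hμu : μ.IsUnitary)
    (hμω : ∀ x : ideleGroup ↥(maximalRealSubfield L), μ (AdeleRing.ideleBaseChange (↥(maximalRealSubfield L)) L x) = quadraticHeckeCharCM L x)
    (f : ((cmDatum L 2 (Matrix.of fun i j : Fin 2 => if i.val + j.val + 1 = 2 then (1 : L) else 0)).Local v × (cmDatum L 1 (Matrix.of fun i j : Fin 1 => if i.val + j.val + 1 = 1 then (1 : L) else 0)).Local v) → ℂ) (hf : IsLocSmooth f)
    (t₀ : ((cmDatum L 2 (Matrix.of fun i j : Fin 2 => if i.val + j.val + 1 = 2 then (1 : L) else 0)).Local v × (cmDatum L 1 (Matrix.of fun i j : Fin 1 => if i.val + j.val + 1 = 1 then (1 : L) else 0)).Local v)) (P : GL (Fin 2) (LocalRing L v)) (d : Fin 2 → (LocalRing L v))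
    (ht₀ : IsRegularElt (t₀.1.val : GL (Fin 2) (LocalRing L v)))
    (hP : (t₀.1.val.val : Matrix (Fin 2) (Fin 2) (LocalRing L v)) * P.val = P.val * Matrix.diagonal d)
    (hd1 : ∀ i, conjLocal L (IsCMField.complexConj L) v (d i) * d i = 1)
    :
    ∃ fC : ↥(Subgroup.centralizer ({t₀} : Set ((cmDatum L 2 (Matrix.of fun i j : Fin 2 => if i.val + j.val + 1 = 2 then (1 : L) else 0)).Local v × (cmDatum L 1 (Matrix.of fun i j : Fin 1 => if i.val + j.val + 1 = 1 then (1 : L) else 0)).Local v))) → ℂ, IsLocallyConstant fC ∧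
      ∀ t : ↥(Subgroup.centralizer ({t₀} : Set ((cmDatum L 2 (Matrix.of fun i j : Fin 2 => if i.val + j.val + 1 = 2 then (1 : L) else 0)).Local v × (cmDatum L 1 (Matrix.of fun i j : Fin 1 => if i.val + j.val + 1 = 1 then (1 : L) else 0)).Local v))), IsRegularElt ((t : ((cmDatum L 2 (Matrix.of fun i j : Fin 2 => if i.val + j.val + 1 = 2 then (1 : L) else 0)).Local v × (cmDatum L 1 (Matrix.of fun i j : Fin 1 => if i.val + j.val + 1 = 1 then (1 : L) else 0)).Local v)).1.val : GL (Fin 2) (LocalRing L v)) → ∀ t' : ((cmDatum L 2 (Matrix.of fun i j : Fin 2 => if i.val + j.val + 1 = 2 then (1 : L) else 0)).Local v × (cmDatum L 1 (Matrix.of fun i j : Fin 1 => if i.val + j.val + 1 = 1 then (1 : L) else 0)).Local v),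
        IsLocalStablyConjH L v (t : ((cmDatum L 2 (Matrix.of fun i j : Fin 2 => if i.val + j.val + 1 = 2 then (1 : L) else 0)).Local v × (cmDatum L 1 (Matrix.of fun i j : Fin 1 => if i.val + j.val + 1 = 1 then (1 : L) else 0)).Local v)) t' → ¬ IsConj (t : ((cmDatum L 2 (Matrix.of fun i j : Fin 2 => if i.val + j.val + 1 = 2 then (1 : L) else 0)).Local v × (cmDatum L 1 (Matrix.of fun i j : Fin 1 => if i.val + j.val + 1 = 1 then (1 : L) else 0)).Local v)) t' →
        ((finHeckeValue L v μ (((P⁻¹).val * ((t : ((cmDatum L 2 (Matrix.of fun i j : Fin 2 => if i.val + j.val + 1 = 2 then (1 : L) else 0)).Local v × (cmDatum L 1 (Matrix.of fun i j : Fin 1 => if i.val + j.val + 1 = 1 then (1 : L) else 0)).Local v)).1.val.val : Matrix (Fin 2) (Fin 2) (LocalRing L v)) * P.val) 0 0 - ((P⁻¹).val * ((t : ((cmDatum L 2 (Matrix.of fun i j : Fin 2 => if i.val + j.val + 1 = 2 then (1 : L) else 0)).Local v × (cmDatum L 1 (Matrix.of fun i j : Fin 1 => if i.val + j.val + 1 =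 1 then (1 : L) else 0)).Local v)).1.val.val : Matrix (Fin 2) (Fin 2) (LocalRing L v)) * P.val) 1 1))⁻¹ : ℂ) * ((Real.sqrt (∏ w' : PlacesOver L v, ‖(((P⁻¹).val * ((t : ((cmDatum L 2 (Matrix.of fun i j : Fin 2 => if i.val + j.val + 1 = 2 then (1 : L) else 0)).Local v × (cmDatum L 1 (Matrix.of fun i j : Fin 1 => if i.val + j.val + 1 = 1 then (1 : L) else 0)).Local v)).1.val.val : Matrix (Fin 2) (Fin 2) (LocalRing L v)) * P.val) 0 0 - ((P⁻¹).val * ((t : ((cmDatum L 2 (Matrix.of fun i j : Fin 2 => if i.val + j.val + 1 = 2 then (1 : L) else 0)).Local v × (cmDatum L 1 (Matrix.of fun i j : Fin 1 => if i.val + j.val + 1 = 1 then (1 : L) else 0)).Local v)).1.val.val : Matrix (Fin 2) (Fin 2) (LocalRing L v)) * P.val) 1 1) w'‖) : ℝ) : ℂ) * ((∫ y, f (y * (t : ((cmDatum L 2 (Matrix.of fun i j : Fin 2 => if i.val + j.val + 1 = 2 then (1 : L) else 0)).Local v × (cmDatum L 1 (Matrix.of fun i j : Fin 1 => if i.val +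 j.val + 1 = 1 then (1 : L) else 0)).Local v)) * y⁻¹) ∂ν) - ∫ y, f (y * t' * y⁻¹) ∂ν) = fC t := by
  classical
  have _hμu := hμu
  have _hwild := hwild
  have hc1 : IsCMField.complexConj L ≠ 1 := IsCMField.complexConj_ne_one L
  -- the place `w`: one above `v`, `c • w = w`, ramified; `σ_w` is an involution
  obtain ⟨w⟩ : Nonempty (PlacesOver L v) := inferInstance
  have hw : IsCMField.complexConj L • w.1 = w.1 := smul_eq_of_subsingleton_placesOver_ENDW L v hv w
  have he : v.asIdeal.ramificationIdx' w.1.asIdeal ≠ 1 := ramificationIdx'_ne_one_of_not_isUnramifiedIn L v hv hram w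
  have hσσ : ∀ x : (w.1.adicCompletion L), (galAdicCompletionMap (L := L) (IsCMField.complexConj L) hw) ((galAdicCompletionMap (L := L) (IsCMField.complexConj L) hw) x) = x :=
    fun x => galAdicCompletionMap_galAdicCompletionMap_of_smul_eq (IsCMField.complexConj L) w hc1 hw x
  -- the datum: anti-fixed `α` (unit or uniformiser), uniformisers `ϖF` of `L⁺_v` and `τ` of `L_w`, the Eisenstein coefficients of `τ`
  obtain ⟨αu, hα, hvα⟩ := exists_units_galAdicCompletionMap_complexConj_eq_neg_of_ramified L w hw he
  obtain ⟨ϖF, hϖF⟩ : ∃ ϖF : (v.adicCompletion ↥(maximalRealSubfield L)), Valued.v ϖF = WithZero.exp (-1 : ℤ) := ⟨_, HeckeCharacter.valued_uniformizer (K := ↥(maximalRealSubfield L)) (v := v)⟩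
  obtain ⟨τ, hτv⟩ : ∃ τ : (w.1.adicCompletion L), Valued.v τ = WithZero.exp (-1 : ℤ) := ⟨_, HeckeCharacter.valued_uniformizer (K := L) (v := w.1)⟩
  obtain ⟨u₀, v₀, _hsq, htr, hnm, hu, hu1, hv1⟩ := exists_eisenstein_coeffs_of_ramified' L v w hw he hϖF hτv
  -- ★ (P1): the standard-position conjugator `ĝ` and the rescaling unit `c`
  obtain ⟨ĝ, c, hc, hposT⟩ := exists_conj_standardPosition L v w hw he hα αu.ne_zero hτv htr hnm (localNonsplitEquiv (IsCMField.complexConj L) (Matrix.of fun i j : Fin 2 => if i.val + j.val + 1 = 2 then (1 : L) else 0) (IsCMField.complexConj_ne_one L) w hw) (fun _ => rfl) t₀ P d ht₀ hP hd1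
  -- ★ A-p01: the rescaled Eisenstein datum `(ι c·τ; c·u₀, c²·v₀)`
  obtain ⟨hτv', hsq', htr', _hnm', hu', hu1', hv1', _hbasis, _hint, hE'⟩ := eisensteinBasis_rescale L v w hw he hτv htr hnm hu hu1 hv1 hc
  have hτE0 : toPlace v w c * τ ≠ 0 := fun h0 => by
    rw [h0, map_zero] at hτv'
    exact WithZero.zero_ne_coe hτv'
  -- `uη := diag(τE, (σ_w τE)⁻¹) ∈ U_w`
  obtain ⟨uη', huη'⟩ := exists_mem_unitaryGroupOfForm_antidiag_coe_eq_diagonal (galAdicCompletionMap (L := L) (IsCMField.complexConj L) hw) hτE0 (hσσ (toPlace v w c * τ))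
  have huηmem : ((uη' : ↥(unitaryGroupOfForm (galAdicCompletionMap (L := L) (IsCMField.complexConj L) hw) !![(0 : (w.1.adicCompletion L)), 1; 1, 0])) : GL (Fin 2) (w.1.adicCompletion L)) ∈ unitaryGroupOfForm (galAdicCompletionMap (L := L) (IsCMField.complexConj L) hw) (placeForm (Matrix.of fun i j : Fin 2 => if i.val + j.val + 1 = 2 then (1 : L) else 0) w.1) := by
    rw [unitaryGroupOfForm_placeForm_antidiagTwo_eq]; exact uη'.2
  -- the root vertex `x₀ = latt 1` and ★ (B6-K) its stabiliser `K` (open, compact)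
  have hx₀S : IsSpecialLattice (RingHom.id (v.adicCompletion ↥(maximalRealSubfield L))) ϖF !![(0 : (v.adicCompletion ↥(maximalRealSubfield L))), 1; -1, 0] (latt (1 : Matrix (Fin 2) (Fin 2) (v.adicCompletion ↥(maximalRealSubfield L)))) := by
    have hϖ0 : ϖF ≠ 0 := fun h0 => by rw [h0, map_zero] at hϖF; exact WithZero.zero_ne_coe hϖF
    have h := isSpecialLattice_latt_of_valuation_det hϖ0 (1 : GL (Fin 2) (v.adicCompletion ↥(maximalRealSubfield L))) (e := 0) (Or.inl rfl) (by rw [Units.val_one, Matrix.det_one, zpow_zero])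
    rwa [Units.val_one] at h
  obtain ⟨K, hK, hKo, hKc⟩ := exists_rootStabilizer_rhoVertexActPlace L v w hw he hα αu.ne_zero hvα hϖF (localNonsplitEquiv (IsCMField.complexConj L) (Matrix.of fun i j : Fin 2 => if i.val + j.val + 1 = 2 then (1 : L) else 0) (IsCMField.complexConj_ne_one L) w hw) (fun _ => rfl) ⟨latt (1 : Matrix (Fin 2) (Fin 2) (v.adicCompletion ↥(maximalRealSubfield L))), hx₀S⟩ rfl
  -- §1 at the conjugated datum `((ĝ,1) t₀ (ĝ,1)⁻¹, ĝ·P, d)`, transported back by ★ (P2)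
  exact core_of_core_conj L v ν μ f t₀ P ((ĝ, 1) : ((cmDatum L 2 (Matrix.of fun i j : Fin 2 => if i.val + j.val + 1 = 2 then (1 : L) else 0)).Local v × (cmDatum L 1 (Matrix.of fun i j : Fin 1 => if i.val + j.val + 1 = 1 then (1 : L) else 0)).Local v))
    (rankOneUnstable_core_ramified_wild_of_pos L v w hw he μ ν hμω f hf (((ĝ, 1) : ((cmDatum L 2 (Matrix.of fun i j : Fin 2 => if i.val + j.val + 1 = 2 then (1 : L) else 0)).Local v × (cmDatum L 1 (Matrix.of fun i j : Fin 1 => if i.val + j.val + 1 = 1 then (1 : L) else 0)).Local v)) * t₀ * ((ĝ, 1) : ((cmDatum L 2 (Matrix.of fun i j : Fin 2 => if i.val + j.val + 1 = 2 then (1 : L) else 0)).Local v × (cmDatum L 1 (Matrix.of fun i j : Fin 1 => if i.val + j.val + 1 = 1 then (1 : L) else 0)).Local v))⁻¹) ((((ĝ, 1) : ((cmDatum L 2 (Matrix.of fun i j : Fin 2 => if i.val + j.val + 1 = 2 then (1 : L) else 0)).Local v × (cmDatum L 1 (Matrix.of fun i j : Fin 1 => if i.val + j.val + 1 = 1 then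 (1 : L) else 0)).Local v))).1.val * P) d
      (isRegularElt_val_conj L 2 (Matrix.of fun i j : Fin 2 => if i.val + j.val + 1 = 2 then (1 : L) else 0) v t₀.1 ĝ ht₀)
      (frame_conj_mul_ENDW L v ((ĝ, 1) : ((cmDatum L 2 (Matrix.of fun i j : Fin 2 => if i.val + j.val + 1 = 2 then (1 : L) else 0)).Local v × (cmDatum L 1 (Matrix.of fun i j : Fin 1 => if i.val + j.val + 1 = 1 then (1 : L) else 0)).Local v)) t₀ P d hP) hd1 (localNonsplitEquiv (IsCMField.complexConj L) (Matrix.of fun i j : Fin 2 => if i.val + j.val + 1 = 2 then (1 : L) else 0) (IsCMField.complexConj_ne_one L) w hw) (fun _ => rfl)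
      hα αu.ne_zero hϖF K ⟨latt (1 : Matrix (Fin 2) (Fin 2) (v.adicCompletion ↥(maximalRealSubfield L))), hx₀S⟩ rfl hK hKo hKc hu' hu1' hv1' hE' (by rw [← pow_two]; exact hsq') (eq_sub_of_add_eq' htr')
      (Units.mk0 (toPlace v w c * τ) hτE0) hτv' ⟨(uη' : GL (Fin 2) (w.1.adicCompletion L)), huηmem⟩ huη' hposT)

end Head

/-! ## §3 The junction for the pen: the named WILD residue, discharged -/

/-- **«N6nsGerm» `stub_N6nsR1ramWild` BY NAME**: the wild residue `RankOneUnstableTransferNonsplitCMERamifiedWild` (★ def p843764) holds — ★ p843935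
`rankOneUnstableTransferNonsplitCMERamifiedWild_of_core_wild` at §2. [cite: Rogawski1990, §4.9 Lemma 4.9.3 (4.9.2) p. 56] [cite: LabesseLanglands1979, §2] -/
theorem rankOneUnstableTransferNonsplitCMERamifiedWild_holds : RankOneUnstableTransferNonsplitCMERamifiedWild :=
  rankOneUnstableTransferNonsplitCMERamifiedWild_of_core_wild rankOneUnstable_core_ramified_wild

/-- **The ramified residue `RankOneUnstableTransferNonsplitCMERamified`, UNCONDITIONAL**: ★ p843935's tame∕wild fold at the TAME END ★ p844041 and §2 — no named residue left.
[cite: Rogawski1990, §4.9 Lemma 4.9.3 (4.9.2) p. 56] [cite: LabesseLanglands1979, §2 Lemma 2.1 pp. 8–10] -/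
theorem rankOneUnstableTransferNonsplitCMERamified_holds : RankOneUnstableTransferNonsplitCMERamified :=
  rankOneUnstableTransferNonsplitCMERamifiedWild_of_core_wild rankOneUnstable_core_ramified_wild |>
    rankOneUnstableTransferNonsplitCMERamified_of_wild

/-- **The (R1) letter `RankOneUnstableTransferNonsplitCME` FROM THREE IN-HOUSE CORES** (inert ★ p843756, tame ★ p844041, wild §2) — ★ p843935's three-core closer; «N6nsGerm»
`stub_N6nsR1LL` BY NAME. [cite: Rogawski1990, §4.9 Lemma 4.9.3 (4.9.2) p. 56] [cite: LabesseLanglands1979, §2 Lemma 2.1 pp. 8–10] -/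
theorem rankOneUnstableTransferNonsplitCME_holds : RankOneUnstableTransferNonsplitCME :=
  rankOneUnstableTransferNonsplitCME_of_core_of_core_tame_of_core_wild rankOneUnstable_core_inert rankOneUnstable_core_ramified_tame rankOneUnstable_core_ramified_wild

end Literature.NumberTheory.Rogawski1990

end

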